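import Literature.AnabelianGeometry.SemiGraphs.ProSigmaCompletionZHatTwist
import Literature.AnabelianGeometry.SemiGraphs.SurfaceTypeLoopModels
import Literature.AnabelianGeometry.SemiGraphs.ProSigmaCompletionInjective
import Literature.AnabelianGeometry.SemiGraphs.ProSigmaCompletionWreath
import Literature.AnabelianGeometry.EtaleTheta.ZHatPadicCharacterSurjective
import Literature.GroupTheory.CombinatorialGroupTheory.PuncturedSurfaceGroupFreeBasis
import Mathlib.GroupTheory.SemidirectProduct
import Mathlib.Algebra.Group.Action.End
import HarnessLib

/-!
# The cusp of the ONCE-PUNCTURED TORUS is not characteristic in its pro-`Σ` fundamental group: a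
# continuous automorphism `a ↦ a`, `b ↦ b^λ` (`λ ∈ Ẑ^×`) moving the boundary class `[a,b]^{-1}`

Mochizuki, *Semi-graphs of anabelioids* [SemiAnbd] Example 2.10 p. 31 (pro-`Σ` completions
`ι : Γ_{g,r} → Π` of punctured surface groups, cusp inertia subgroups `closure ι⟨c_j⟩`); *Topics in
Absolute Anabelian Geometry I* [AbsTopI] Lemma 4.5 (v) p. 55 ("by allowing `H` to vary, this yields a
["group-theoretic"] characterization of the decomposition groups of cusps in `Π`" — derived in print
from (iii), the WEIGHTS of the Galois action).

PROOF-ONLY file (abc-iut cell, block F, seat abc-iut-f-090 (gen 5); FACT-LIST row F-0206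
`CuspidalAlgorithm.RecoversCusps`; L4-lead m67 «F-0206 (1,1)» GO 2026-08-26).  The tree decides the
geometric tightness of Lemma 4.5 (v) at every cusped hyperbolic type EXCEPT the once-punctured torus:
`r ≥ 2` by the transvection `c₁ ↦ c₁ s²` (abc-iut-f-060, `ProSigmaSurfaceCuspTransvection.lean`) and
`(g ≥ 2, r ≥ 1)` by the handle swap `a₁ ↔ b₁` (abc-iut-f-060, `ProSigmaSurfaceHandleSwap.lean`) —
both AUTOMORPHISMS OF THE DISCRETE GROUP `Γ_{g,r}`.  At `(1, 1)` no such witness exists: `Γ_{1,1}`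
is free on `a, b` with `c₁ = [a,b]^{-1}` and, by Nielsen, every automorphism of `F(a,b)` carries
`[a,b]` to a conjugate of `[a,b]^{±1}`; moreover `c₁ ∈ [Γ,Γ]` is invisible to every abelian
character.  This file gives a GENUINELY PROFINITE witness, for every genus `g ≥ 1` and any number
`r ≥ 1` of cusps (`exists_continuousMulEquiv_map_cuspInertia_not_conj_of_genus_pos`):

* the TWIST `a₁ ↦ a₁`, `b₁ ↦ b₁^λ`, `λ = φ(η 1) ∈ Ẑ` for a unit `φ ∈ Aut(Ẑ) = Ẑ^×` whose level-`p³`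
  cyclotomic character is `1 + p` (`p ∈ Σ`; such `φ` exists by `Ẑ^× ↠ ℤ_p^×`,
  `ZHatLevel.padicChar_surjective_units`) — a continuous automorphism `ê` of ANY pro-`Σ` completion
  `Q` of `Γ_{g,r}` (`IsProSigmaCompletion.exists_continuousMulEquiv_twistGenerator`: the twisted map
  is itself a pro-`Σ` completion, and pro-`Σ` completions are unique);
* DETECTION in the finite `p`-group `W = (ℤ/p³)^{ℤ/p³} ⋊ ℤ/p³` (Mathlib's `SemidirectProduct` with the
  shift action `mulAutArrow`; order `p^{3(p³+1)}`, a `Σ`-integer): under `a₁ ↦ x = δ₁ ∈ base`,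
  `b₁ ↦ y = shift`, every other generator `↦ 1`, the boundary class `c₁ = (∏[aᵢ,bᵢ] ∏ c_{j+2})^{-1}`
  goes to `[x,y]^{-1} = (δ₁/δ_y)^{-1}` and `ê(c₁)` to `[x,y^{1+p}]^{-1} = (δ₁/δ_{y^{1+p}})^{-1}`,
  which lies in NO `W`-conjugate of `⟨[x,y]⟩ = ⟨δ_t/δ_{ty}⟩` because `y^{1+p} ∉ {1, y, y^{-1}}`
  (evaluate the functions at `1` and at `y^{1+p}`); the extension of the character to `Q`
  (`exists_continuous_extend_top`) transports this to `ê(closure ι⟨c₁⟩) ≠ q · closure ι⟨c_j⟩ · q⁻¹`.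

HONEST FRAMING: classical profinite group theory about surface groups; it shows that the arithmetic
input of [AbsTopI] Lemma 4.5 (iii)/(v) (weights) is NECESSARY also at the once-punctured torus — the
curve type of a once-punctured (Tate) elliptic curve; nothing here bears on [IUTchIII] Cor 3.12; no
abc claim.
-/

noncomputable section

namespace Literature.AnabelianGeometry.SemiGraphs.SemiGraphOfAnabelioids.IsProSigmaCompletion

open scoped Pointwise
open CategoryTheory ProfiniteGrp ProfiniteGrp.ProfiniteCompletion SemidirectProduct
open Literature.GroupTheory.CombinatorialGroupTheory
open Literature.AnabelianGeometry.Anabelioids (IsSigmaInteger)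
open Literature.AnabelianGeometry.EtaleTheta

/-! ### The detecting `p`-group `W = (C → C) ⋊ C` (`C` cyclic): two commutators that are not conjugate -/

section Wreath

variable {C : Type} [CommGroup C] [DecidableEq C]

omit [DecidableEq C] in
/-- Conjugation of a base element `F : C → C` of `W = (C → C) ⋊ C` by `w ∈ W` is the shift by the
`C`-component of `w`. [folklore] -/
private theorem wreath_conj_inl (w : (C → C) ⋊[mulAutArrow] C) (F : C → C) :
    w * inl F * w⁻¹ = inl (mulAutArrow w.right F) := by
  refine SemidirectProduct.ext ?_ ?_
  · simp only [mul_left, mul_right, inv_left, left_inl, right_inl, mul_one, map_inv,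
      MulAut.inv_apply, MulEquiv.apply_symm_apply]
    rw [mul_comm w.left, mul_assoc, mul_inv_cancel, mul_one]
  · simp only [mul_right, inv_right, right_inl, mul_one, mul_inv_cancel]

/-- The commutator `[x, t] = x t x⁻¹ t⁻¹` of the base element `x = δ₁^{y₀}` with `t ∈ C` is the base
element `δ₁^{y₀} / δ_t^{y₀}`. [folklore] -/
private theorem wreath_comm (y₀ t : C) :
    (inl (Pi.mulSingle 1 y₀) * inr t * (inl (Pi.mulSingle 1 y₀))⁻¹ * (inr t)⁻¹ :
        (C → C) ⋊[mulAutArrow] C) =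
      inl ((Pi.mulSingle (1 : C) y₀ : C → C) / (Pi.mulSingle t y₀ : C → C)) := by
  rw [mul_assoc, mul_assoc, ← map_inv, ← map_inv (inr : C →* (C → C) ⋊[mulAutArrow] C),
    ← mul_assoc (inr t), ← SemidirectProduct.inl_aut, ← map_mul, div_eq_mul_inv]
  congr 1
  funext i
  change (Pi.mulSingle (1 : C) y₀ : C → C) i * ((Pi.mulSingle (1 : C) y₀ : C → C) (t⁻¹ * i))⁻¹ =
    (Pi.mulSingle (1 : C) y₀ : C → C) i * ((Pi.mulSingle t y₀ : C → C) i)⁻¹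
  congr 2
  simp only [Pi.mulSingle_apply, inv_mul_eq_one, eq_comm]

/-- **The detection.**  In `W = (C → C) ⋊ C` with `x = δ₁^{y₀}`, `y₀ ≠ 1`: for `y₁ ∉ {1, y₀, y₀⁻¹}` the
element `[x, y₁]⁻¹` lies in NO `W`-conjugate of the cyclic group `⟨[x, y₀]⁻¹⟩` (its base function is
`δ_{y₁}/δ₁`, with support `{1, y₁}`; a conjugate of `[x,y₀]^m` has base function supported on
`{t, t y₀}`; evaluate at `1` and at `y₁`). [folklore] -/
private theorem wreath_key {y₀ y₁ : C} (hy₀ : y₀ ≠ 1) (h1 : y₁ ≠ 1) (h2 : y₁ ≠ y₀) (h3 : y₁ ≠ y₀⁻¹)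
    (w z : (C → C) ⋊[mulAutArrow] C)
    (hz : z ∈ Subgroup.zpowers
      ((inl (Pi.mulSingle (1 : C) y₀ : C → C) * inr y₀ * (inl (Pi.mulSingle (1 : C) y₀ : C → C))⁻¹ *
        (inr y₀)⁻¹ : (C → C) ⋊[mulAutArrow] C)⁻¹)) :
    (inl (Pi.mulSingle (1 : C) y₀ : C → C) * inr y₁ * (inl (Pi.mulSingle (1 : C) y₀ : C → C))⁻¹ *
        (inr y₁)⁻¹ : (C → C) ⋊[mulAutArrow] C)⁻¹ ≠ w * z * w⁻¹ := by
  rw [wreath_comm] at hz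
  rw [wreath_comm]
  obtain ⟨m, hm⟩ := Subgroup.mem_zpowers_iff.mp hz
  subst hm
  rw [← map_inv, ← map_inv, ← map_zpow, wreath_conj_inl]
  intro h
  have h' : ∀ i : C, ((Pi.mulSingle (1 : C) y₀ : C → C) i / (Pi.mulSingle y₁ y₀ : C → C) i)⁻¹ =
      (((Pi.mulSingle (1 : C) y₀ : C → C) (w.right⁻¹ * i) /
        (Pi.mulSingle y₀ y₀ : C → C) (w.right⁻¹ * i))⁻¹) ^ m :=
    fun i => congr_fun (inl_injective h) i
  have e1 := h' 1
  have e2 := h' y₁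
  simp only [Pi.mulSingle_apply, mul_one, if_neg h1.symm, if_neg h1, div_one, one_div, inv_inv] at e1 e2
  by_cases ht1 : w.right⁻¹ = 1
  · -- `t = 1`: read the equation at `y₁`
    rw [ht1, one_mul, if_neg h1, if_neg h2, div_one, inv_one, one_zpow] at e2
    exact hy₀ e2
  · by_cases ht2 : w.right⁻¹ = y₀
    · -- `t = y₀⁻¹`: read the equation at `y₁`
      have hne1 : w.right⁻¹ * y₁ ≠ 1 := by
        rw [ht2]; intro hh; exact h3 (eq_inv_of_mul_eq_one_right hh)
      have hne2 : w.right⁻¹ * y₁ ≠ y₀ := by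
        rw [ht2]; intro hh; exact h1 (mul_eq_left.mp hh)
      rw [if_neg hne1, if_neg hne2, div_one, inv_one, one_zpow] at e2
      exact hy₀ e2
    · -- generic `t`: read the equation at `1`
      rw [if_neg ht1, if_neg ht2, div_one, inv_one, one_zpow] at e1
      exact hy₀ (inv_eq_one.mp e1)

/-- The companion for the trivial cyclic group: `[x, y₁]⁻¹ ≠ 1`. [folklore] -/
private theorem wreath_key_one {y₀ y₁ : C} (hy₀ : y₀ ≠ 1) (h1 : y₁ ≠ 1)
    (w z : (C → C) ⋊[mulAutArrow] C) (hz : z ∈ Subgroup.zpowers (1 : (C → C) ⋊[mulAutArrow] C)) :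
    (inl (Pi.mulSingle (1 : C) y₀ : C → C) * inr y₁ * (inl (Pi.mulSingle (1 : C) y₀ : C → C))⁻¹ *
        (inr y₁)⁻¹ : (C → C) ⋊[mulAutArrow] C)⁻¹ ≠ w * z * w⁻¹ := by
  rw [Subgroup.zpowers_one_eq_bot, Subgroup.mem_bot] at hz
  subst hz
  rw [mul_one, mul_inv_cancel, wreath_comm, ← map_inv, Ne, map_eq_one_iff _ inl_injective]
  intro h
  have e1 := congr_fun h 1
  simp only [Pi.inv_apply, Pi.div_apply, Pi.mulSingle_apply, if_neg h1.symm, div_one,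
    Pi.one_apply, inv_eq_one] at e1
  exact hy₀ e1

omit [DecidableEq C] in
/-- `|W| = |C|^{|C|} · |C|`. [folklore] -/
private theorem wreath_card [Finite C] :
    Nat.card ((C → C) ⋊[mulAutArrow] C) = Nat.card C ^ Nat.card C * Nat.card C := by
  rw [SemidirectProduct.card, Nat.card_fun]

end Wreath

/-! ### A unit of `Ẑ` with prescribed level-`p³` character -/

/-- There is `φ ∈ Aut(Ẑ) = Ẑ^×` whose level-`p³` cyclotomic character is `1 + p` (lift the unit
`1 + p ∈ ℤ_p^×` along `Ẑ^× ↠ ℤ_p^×`). [cite: RibesZalesskii2010, Thm 2.7.1] -/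
theorem exists_mulAut_levelChar_val_eq_one_add (p : ℕ) [hp : Fact p.Prime] :
    ∃ φ : MulAut (completion (GrpCat.of (Multiplicative ℤ))),
      (ZHatLevel.levelChar (ZHatLevel.ppow p 3) φ).val = 1 + p := by
  have h1p : (1 : ℝ) < p := by exact_mod_cast hp.out.one_lt
  have hnorm : ‖(1 : ℤ_[p]) + (p : ℤ_[p])‖ = 1 := by
    have hne : ‖(1 : ℤ_[p])‖ ≠ ‖(p : ℤ_[p])‖ := by
      rw [norm_one, PadicInt.norm_p]
      exact (inv_lt_one_of_one_lt₀ h1p).ne'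
    rw [PadicInt.norm_add_eq_max_of_ne hne, norm_one, PadicInt.norm_p, max_eq_left]
    exact (inv_lt_one_of_one_lt₀ h1p).le
  have hu : IsUnit ((1 : ℤ_[p]) + (p : ℤ_[p])) := PadicInt.isUnit_iff.mpr hnorm
  obtain ⟨φ, hφ⟩ := ZHatLevel.padicChar_surjective_units p hu.unit
  refine ⟨φ, ?_⟩
  have h := ZHatLevel.toZModPow_padicChar p φ 3
  rw [hφ, IsUnit.unit_spec] at h
  have h2 : (ZHatLevel.levelChar (ZHatLevel.ppow p 3) φ).val = (((1 + p : ℕ)) : ZMod (p ^ 3)).val := by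
    rw [← h, map_add, map_one, map_natCast, Nat.cast_add, Nat.cast_one]
    rfl
  have hlt : 1 + p < p ^ 3 := by
    have h2le : 2 ≤ p := hp.out.two_le
    have : p * p * p = p ^ 3 := by ring
    nlinarith
  rw [h2, ZMod.val_natCast, Nat.mod_eq_of_lt hlt]

/-- The three separations `1 + p ∉ {0, 1, −1}` in `ℤ/p³`. [folklore] -/
private theorem one_add_prime_separations (p : ℕ) [hp : Fact p.Prime] :
    (1 + (p : ZMod (p ^ 3)) ≠ 0) ∧ (1 + (p : ZMod (p ^ 3)) ≠ 1) ∧ (1 + (p : ZMod (p ^ 3)) ≠ -1) := by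
  have h2 : 2 ≤ p := hp.out.two_le
  have h8 : p + 2 < p ^ 3 := by
    have : p * p * p = p ^ 3 := by ring
    nlinarith
  refine ⟨?_, ?_, ?_⟩
  · intro h
    have h' : ((1 + p : ℕ) : ZMod (p ^ 3)) = 0 := by push_cast; exact h
    rw [ZMod.natCast_eq_zero_iff] at h'
    exact absurd (Nat.le_of_dvd (by omega) h') (by omega)
  · intro h
    have h' : ((p : ℕ) : ZMod (p ^ 3)) = 0 := by
      have := congrArg (fun z => z - 1) h
      simpa using this
    rw [ZMod.natCast_eq_zero_iff] at h'
    exact absurd (Nat.le_of_dvd hp.out.pos h') (by nlinarith)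
  · intro h
    have h' : ((p + 2 : ℕ) : ZMod (p ^ 3)) = 0 := by
      have := congrArg (fun z => z + 1) h
      simp only [neg_add_cancel] at this
      push_cast
      linear_combination this
    rw [ZMod.natCast_eq_zero_iff] at h'
    exact absurd (Nat.le_of_dvd (by omega) h') (by omega)

/-! ### The main theorem -/

universe u

variable {Sigma : Set ℕ} {g r : ℕ} {Q : Type} [Group Q] [TopologicalSpace Q] [IsTopologicalGroup Q]
  [CompactSpace Q] [TotallyDisconnectedSpace Q]

/-- **A pro-`Σ` completion of `Γ_{g,r}` with `g ≥ 1`, `r ≥ 1` — in particular of the once-punctured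
torus group `Γ_{1,1}` — carries a continuous automorphism moving the closed inertia group of the cusp
`c₁` (index `0`) off EVERY cuspidal conjugacy class**: `ê(closure ι⟨c₁⟩) ≠ q · closure ι⟨c_y⟩ · q⁻¹`
for all cusps `y` and all `q ∈ Π`.  (`ê` is the profinite twist `b₁ ↦ b₁^λ`, `λ ∈ Ẑ^×` with
`λ ≡ 1 + p (mod p³)`; a character to the `p`-group `(ℤ/p³)^{ℤ/p³} ⋊ ℤ/p³` separates.)  Hence the
conjugacy class of the cusp inertia subgroup of a once-punctured torus is NOT preserved by the
continuous automorphisms of its pro-`Σ` fundamental group, although it is preserved (up to sign) by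
every automorphism of the discrete `Γ_{1,1} = F₂` (Nielsen): the "group-theoretic characterization of
the decomposition groups of cusps" of [AbsTopI] Lemma 4.5 (v) needs the arithmetic quotient
`Π ↠ G_k` (weights, Lemma 4.5 (iii)) at EVERY cusped hyperbolic type.
[cite: MochizukiAbsTopI2012, Lemma 4.5 (v) p.55] [cite: MochizukiSemiAnbd2006, Ex. 2.10 p.31] -/
theorem exists_continuousMulEquiv_map_cuspInertia_not_conj_of_genus_pos (hne : Sigma.Nonempty)
    (hprime : ∀ p ∈ Sigma, p.Prime)
    (ι : PuncturedSurfaceGroup (g + 1) (r + 1) →* Q) (hι : IsProSigmaCompletion Sigma ι) :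
    ∃ e : Q ≃ₜ* Q, ∀ (y : Fin (r + 1)) (q : Q),
      ((PuncturedSurfaceGroup.cuspInertia (g := g + 1) (0 : Fin (r + 1))).map ι).topologicalClosure.map
          e.toMulEquiv.toMonoidHom ≠
        ConjAct.toConjAct q •
          ((PuncturedSurfaceGroup.cuspInertia (g := g + 1) y).map ι).topologicalClosure := by
  classical
  obtain ⟨p, hpS⟩ := hne
  haveI hp : Fact p.Prime := ⟨hprime p hpS⟩
  -- the unit `λ` of `Ẑ` and the profinite twist `ê`
  obtain ⟨φ, hφ⟩ := exists_mulAut_levelChar_val_eq_one_add p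
  let L : Type := (Fin (g + 1) × Bool) ⊕ Fin r
  let a₁ : L := Sum.inl (0, false)
  let b₁ : L := Sum.inl (0, true)
  have hab : a₁ ≠ b₁ := fun h => Bool.false_ne_true (Prod.mk.inj (Sum.inl_injective h)).2
  let fe := PuncturedSurfaceGroup.freeEquiv (g + 1) r
  let ι₀ : FreeGroup L →* Q := ι.comp fe.symm.toMonoidHom
  have hι₀ : IsProSigmaCompletion Sigma ι₀ := hι.comp_mulEquiv fe.symm
  have hιfe : ∀ γ, ι γ = ι₀ (fe γ) := fun γ => by
    change ι γ = ι (fe.symm (fe γ)); rw [MulEquiv.symm_apply_apply]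
  obtain ⟨P, e, hP, hes, het⟩ := hι₀.exists_continuousMulEquiv_twistGenerator b₁ φ
  -- the detecting `p`-group `W` and the character `f`
  let C : Type := Multiplicative (ZMod (p ^ 3))
  let W : Type := (C → C) ⋊[mulAutArrow] C
  haveI : Finite W := Finite.of_equiv ((C → C) × C)
    (SemidirectProduct.equivProd (N := C → C) (G := C) (φ := mulAutArrow)).symm
  letI : TopologicalSpace W := ⊥
  haveI : DiscreteTopology W := ⟨rfl⟩
  let y₀ : C := Multiplicative.ofAdd 1
  let x : W := inl (Pi.mulSingle (1 : C) y₀ : C → C)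
  let yy : W := inr y₀
  let wt : L → W := fun t => if t = a₁ then x else if t = b₁ then yy else 1
  have hwa : wt a₁ = x := by simp [wt]
  have hwb : wt b₁ = yy := by simp [wt, hab.symm]
  let ψ : FreeGroup L →* W := FreeGroup.lift wt
  have hψ : ∀ t, ψ (FreeGroup.of t) = wt t := fun t => FreeGroup.lift_apply_of
  let f : PuncturedSurfaceGroup (g + 1) (r + 1) →* W := ψ.comp fe.toMonoidHom
  have hf : ∀ γ, f γ = ψ (fe γ) := fun γ => rfl
  -- `|W| = p³ · (p³)^{p³}`, a `Σ`-integer; the exponent `e = |W|` as a multiple of the level `p³`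
  have hC : Nat.card C = p ^ 3 := by change Nat.card (ZMod (p ^ 3)) = _; exact Nat.card_zmod _
  let m : ℕ+ := ⟨(p ^ 3) ^ (p ^ 3), pow_pos (pow_pos hp.out.pos 3) _⟩
  have hcardW : Nat.card W = ((ZHatLevel.ppow p 3 * m : ℕ+) : ℕ) := by
    change Nat.card ((C → C) ⋊[mulAutArrow] C) = p ^ 3 * (p ^ 3) ^ (p ^ 3)
    rw [wreath_card, hC, mul_comm]
  have hW : IsSigmaInteger Sigma (Nat.card W) := by
    rw [hcardW]
    change IsSigmaInteger Sigma (p ^ 3 * (p ^ 3) ^ (p ^ 3))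
    rw [← pow_mul]
    exact (isSigmaInteger_prime_pow hp.out hpS 3).mul (isSigmaInteger_prime_pow hp.out hpS _)
  have he : ∀ w : W, w ^ ((ZHatLevel.ppow p 3 * m : ℕ+) : ℕ) = 1 := fun w => by
    rw [← hcardW]; exact pow_card_eq_one'
  obtain ⟨F, hFc, hFι⟩ := hι.exists_continuous_extend_top hW f
  -- the exponent seen by `W`: `k ≡ 1 + p (mod p³)`
  set k : ℕ := (ZHatLevel.levelChar (ZHatLevel.ppow p 3 * m) φ).val with hkdef
  have hk : ((k : ℕ) : ZMod (p ^ 3)) = 1 + (p : ZMod (p ^ 3)) := by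
    rw [← ZMod.natCast_mod k (p ^ 3)]
    change (((k % (ZHatLevel.ppow p 3 : ℕ) : ℕ)) : ZMod (p ^ 3)) = _
    rw [hkdef, ZHatLevel.val_levelChar_mul_mod, hφ, Nat.cast_add, Nat.cast_one]
  let y₁ : C := y₀ ^ k
  have hy₁ : y₁ = Multiplicative.ofAdd (1 + (p : ZMod (p ^ 3))) := by
    change Multiplicative.ofAdd (1 : ZMod (p ^ 3)) ^ k = _
    rw [← ofAdd_nsmul, nsmul_eq_mul, mul_one, hk]
  obtain ⟨s0, s1, s2⟩ := one_add_prime_separations p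
  haveI : Fact (1 < p ^ 3) := ⟨Nat.one_lt_pow three_ne_zero hp.out.one_lt⟩
  have hy₀ : y₀ ≠ 1 := by
    change Multiplicative.ofAdd (1 : ZMod (p ^ 3)) ≠ Multiplicative.ofAdd 0
    rw [Ne, Multiplicative.ofAdd.injective.eq_iff]
    exact one_ne_zero
  have h1 : y₁ ≠ 1 := by
    rw [hy₁]; exact fun h => s0 (Multiplicative.ofAdd.injective (h.trans ofAdd_zero.symm))
  have h2 : y₁ ≠ y₀ := by
    rw [hy₁]; exact fun h => s1 (Multiplicative.ofAdd.injective h)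
  have h3 : y₁ ≠ y₀⁻¹ := by
    rw [hy₁]; exact fun h => s2 (Multiplicative.ofAdd.injective (h.trans (ofAdd_neg _).symm))
  -- values of `F` on the twisted generators
  have hFι₀ : ∀ t, F (ι₀ (FreeGroup.of t)) = wt t := fun t => by
    change F (ι (fe.symm (FreeGroup.of t))) = wt t
    rw [hFι, hf, MulEquiv.apply_symm_apply, hψ]
  have hFP : F (P (φ (ZHatLevel.eta 1))) = yy ^ k := by
    rw [apply_zhatPow_eq_pow P F (ZHatLevel.ppow p 3 * m) he, hP, hFι₀, hwb, ← ZHatLevel.levelChar_apply]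
  -- `F ∘ ê ∘ ι₀` is the character with `b₁ ↦ y^k`
  let wt' : L → W := fun t => if t = a₁ then x else if t = b₁ then yy ^ k else 1
  let ψ' : FreeGroup L →* W := FreeGroup.lift wt'
  have hψ' : ∀ t, ψ' (FreeGroup.of t) = wt' t := fun t => FreeGroup.lift_apply_of
  have hFe : F.comp (e.toMonoidHom.comp ι₀) = ψ' := by
    refine FreeGroup.ext_hom _ _ fun t => ?_
    rw [MonoidHom.comp_apply, MonoidHom.comp_apply, hψ']
    change F (e (ι₀ (FreeGroup.of t))) = wt' t
    by_cases ht : t = b₁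
    · rw [ht, hes, hFP]; simp [wt', hab.symm]
    · rw [het t ht, hFι₀]; simp [wt, wt', ht]
  -- the commutator products under the two characters
  have hcomm : ∀ (χ : L → W), (∀ i : Fin (g + 1), i ≠ 0 → χ (Sum.inl (i, false)) = 1) →
      FreeGroup.lift χ (PuncturedSurfaceGroup.commProd (g + 1) r) =
        χ a₁ * χ b₁ * (χ a₁)⁻¹ * (χ b₁)⁻¹ := by
    intro χ hχ
    rw [PuncturedSurfaceGroup.commProd, map_list_prod, List.map_map, List.finRange_succ, List.map_cons,
      List.prod_cons, List.map_map]
    have htail : ((List.finRange g).map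
        ((⇑(FreeGroup.lift χ) ∘ fun i : Fin (g + 1) =>
          FreeGroup.of (Sum.inl (i, false)) * FreeGroup.of (Sum.inl (i, true)) *
            (FreeGroup.of (Sum.inl (i, false)))⁻¹ * (FreeGroup.of (Sum.inl (i, true)))⁻¹) ∘ Fin.succ)).prod = 1 := by
      refine List.prod_eq_one fun w hw => ?_
      obtain ⟨i, -, rfl⟩ := List.mem_map.mp hw
      simp only [Function.comp_apply, map_mul, map_inv, FreeGroup.lift_apply_of,
        hχ (Fin.succ i) (Fin.succ_ne_zero i), one_mul, inv_one, mul_one, mul_inv_cancel]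
    rw [htail, mul_one]
    simp only [Function.comp_apply, map_mul, map_inv, FreeGroup.lift_apply_of]
    rfl
  have hcusp : ∀ (χ : L → W), (∀ j : Fin r, χ (Sum.inr j) = 1) →
      FreeGroup.lift χ (PuncturedSurfaceGroup.cuspProd (g + 1) r) = 1 := by
    intro χ hχ
    rw [PuncturedSurfaceGroup.cuspProd, map_list_prod, List.map_map]
    exact List.prod_eq_one fun w hw => by
      obtain ⟨j, -, rfl⟩ := List.mem_map.mp hw
      rw [Function.comp_apply, FreeGroup.lift_apply_of, hχ j]
  have hia : ∀ i : Fin (g + 1), i ≠ 0 → (Sum.inl (i, false) : L) ≠ a₁ := fun i hi h =>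
    hi (Prod.mk.inj (Sum.inl_injective h)).1
  have hib : ∀ i : Fin (g + 1), (Sum.inl (i, false) : L) ≠ b₁ := fun i h =>
    Bool.false_ne_true (Prod.mk.inj (Sum.inl_injective h)).2
  have hwt_a : ∀ i : Fin (g + 1), i ≠ 0 → wt (Sum.inl (i, false)) = 1 := fun i hi => by
    simp only [wt, if_neg (hia i hi), if_neg (hib i)]
  have hwt'_a : ∀ i : Fin (g + 1), i ≠ 0 → wt' (Sum.inl (i, false)) = 1 := fun i hi => by
    simp only [wt', if_neg (hia i hi), if_neg (hib i)]
  have hwt_c : ∀ j : Fin r, wt (Sum.inr j) = 1 := fun j => by simp [wt, a₁, b₁]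
  have hwt'_c : ∀ j : Fin r, wt' (Sum.inr j) = 1 := fun j => by simp [wt', a₁, b₁]
  -- `f(c₁) = [x,y]⁻¹`, `F(ê(ι c₁)) = [x,y^k]⁻¹`, `f(c_{j+2}) = 1`
  have hfzero : f (PuncturedSurfaceGroup.c 0) = (x * yy * x⁻¹ * yy⁻¹)⁻¹ := by
    rw [hf, PuncturedSurfaceGroup.freeEquiv_c_zero, map_mul, map_inv, map_inv, hcomm wt hwt_a,
      hcusp wt hwt_c, hwa, hwb, inv_one, mul_one]
  have hFe_zero : F (e (ι (PuncturedSurfaceGroup.c 0))) = (x * yy ^ k * x⁻¹ * (yy ^ k)⁻¹)⁻¹ := by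
    have := DFunLike.congr_fun hFe (fe (PuncturedSurfaceGroup.c 0))
    rw [MonoidHom.comp_apply, MonoidHom.comp_apply] at this
    change F (e (ι₀ (fe (PuncturedSurfaceGroup.c 0)))) = _ at this
    rw [← hιfe] at this
    rw [this, PuncturedSurfaceGroup.freeEquiv_c_zero, map_mul, map_inv, map_inv, hcomm wt' hwt'_a,
      hcusp wt' hwt'_c, inv_one, mul_one]
    simp [wt', hab.symm]
  have hfsucc : ∀ j : Fin r, f (PuncturedSurfaceGroup.c (Fin.succ j)) = 1 := fun j => by
    rw [hf, PuncturedSurfaceGroup.freeEquiv_c_succ, hψ, hwt_c]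
  -- `y^k = inr y₁`
  have hyk : yy ^ k = inr y₁ := by change (inr y₀) ^ k = inr (y₀ ^ k); rw [map_pow]
  -- conclusion
  refine ⟨e, fun y q heq => ?_⟩
  have hmem : e (ι (PuncturedSurfaceGroup.c 0)) ∈
      ((PuncturedSurfaceGroup.cuspInertia (g := g + 1) (0 : Fin (r + 1))).map ι).topologicalClosure.map
        e.toMulEquiv.toMonoidHom :=
    ⟨ι (PuncturedSurfaceGroup.c 0), Subgroup.le_topologicalClosure _
      ⟨PuncturedSurfaceGroup.c 0, Subgroup.mem_zpowers _, rfl⟩, rfl⟩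
  rw [heq, Subgroup.mem_smul_pointwise_iff_exists] at hmem
  obtain ⟨z, hz, hzeq⟩ := hmem
  have hFz : F z ∈ Subgroup.zpowers (f (PuncturedSurfaceGroup.c y)) := by
    rw [← hFι]
    refine map_topologicalClosure_zpowers_le F hFc (ι (PuncturedSurfaceGroup.c y)) ⟨z, ?_, rfl⟩
    rw [← MonoidHom.map_zpowers]
    exact hz
  have hFβ : F (e (ι (PuncturedSurfaceGroup.c 0))) = F q * F z * (F q)⁻¹ := by
    rw [← hzeq, ConjAct.smul_def, ConjAct.ofConjAct_toConjAct, map_mul, map_mul, map_inv]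
  rw [hFe_zero, hyk] at hFβ
  refine Fin.cases ?_ (fun j => ?_) y hFz
  · intro hFz
    rw [hfzero] at hFz
    exact wreath_key hy₀ h1 h2 h3 (F q) (F z) hFz hFβ
  · intro hFz
    rw [hfsucc] at hFz
    exact wreath_key_one hy₀ h1 (F q) (F z) hFz hFβ

end Literature.AnabelianGeometry.SemiGraphs.SemiGraphOfAnabelioids.IsProSigmaCompletion

end
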